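import Summits.AtomisticToContinuum.Crystallization.Theorems.ReggeStarCoercivityDefectFreeCrystallizesExactFrameH

/-!
# Exact stars at a c-type site give an exact frame, I: the contacts of a c-type site of a general Barlow
# stacking and the cuboctahedral link (stub `stub_exactFrameC`, X2b of line `palm-good-law`, crux
# `ReggeStarCoercivity.DefectFreeCrystallizes`, stmt-AtomisticToContinuum-13603; part 1 of 2)

The combinatorics of a c-TYPE site `u` (`s (u.1 − 1) = s u.1 =: σ`) of a general Hägg word `s`.  Its twelve
contacts are labelled by the twelve offsets `I` (the hexagon of layer `0`, the triangle `(1,0,0), (1,−1,0),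
(1,0,−1)` above and the STAGGERED triangle `(−1,0,0), (−1,1,0), (−1,0,1)` below) through the same neighbour map
`N ε = (u.1 + ε.1, u.2.1 + σ ε.2.1, u.2.2 + σ ε.2.2)` as at an h-type site.  The label set `I`, the map `N` and
the integer metric form `Q ε ε' = 3 (2Δε₂ + Δε₃ + Δε₁)² + (3Δε₃ + Δε₁)² + 8 Δε₁²` are carried as variables with
their defining equations `hI`, `hN`, `hQ` (no definitions):

* `dist_eq_one_iff_nbrC`: the sites of the ideal stacking at distance `1` from the site `u` are exactly the
  `N ε`, `ε ∈ I` (`BarlowCoordination.dist_barlowPos_eq_iff` and `decide`d offset tables);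
* `twelve_mul_dist_sq_nbrC`, `dist_nbrC_eq_one_iff`: at the ideal ratio `h² = ⅔ a²` the mutual distances of
  the contacts are `12 · dist² = a² · Q` (the letters of the layers `u.1 ± 1` are `L ± σ`, and `σ² = 1`), and two
  contacts `ε, ε'` touch iff `ε − ε' ∈ I` — the link of a c-type site is the CUBOCTAHEDRAL graph, locally the
  fcc LATTICE;
* `c_edge_one_triangle`, `c_classify` (by `decide`): in that graph every edge lies in exactly one triangle, and
  the metric form of two distinct non-adjacent labels is `48 − 12 · #(common neighbours)` — the whole distance
  table of the cuboctahedron is a function of its contact graph; the same holds for `fccInt`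
  (`fccInt_classify`), whence a contact-graph isomorphism `I → fccInt` carries the metric
  (`six_mul_sqNormInt_eq`);
* `strut_eq_siteVec`, `linearIndependent_strutsC`, `norm_strutC`: the relaxed struts are lattice vectors, the
  three struts `(0,1,0), (0,0,1), (1,0,0)` are linearly independent, and at the ideal ratio all have length `a`.

All `[folklore]`.
-/

noncomputable section

open scoped BigOperators

namespace Summit.AtomisticToContinuum.Crystallization.Theorems.PalmGoodLaw.ExactFrameC

open Literature.MathematicalPhysics.StatisticalMechanics Literature.Geometry.DiscreteGeometry
open Summit.AtomisticToContinuum.Crystallization.Theorems.PalmUnimodularRigidity.LayeredLawsSelectHcp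
open Summit.AtomisticToContinuum.Crystallization.Theorems.PalmGoodLaw.ExactFrameH

/-! ## The label set and its tables -/

section Tables

variable {I : Finset (ℤ × ℤ × ℤ)} {Q : ℤ × ℤ × ℤ → ℤ × ℤ × ℤ → ℤ}

/-- There are twelve contact labels (by `decide`). [folklore] -/
theorem card_cIdx (hI : I = {(0, 1, 0), (0, -1, 0), (0, 0, 1), (0, 0, -1), (0, 1, -1), (0, -1, 1),
      (1, 0, 0), (1, -1, 0), (1, 0, -1), (-1, 0, 0), (-1, 1, 0), (-1, 0, 1)}) :
    I.card = 12 := by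
  subst hI; decide

/-- Contact labels live on the layers `0, ±1` (by `decide`). [folklore] -/
theorem cIdx_fst_cases (hI : I = {(0, 1, 0), (0, -1, 0), (0, 0, 1), (0, 0, -1), (0, 1, -1), (0, -1, 1),
      (1, 0, 0), (1, -1, 0), (1, 0, -1), (-1, 0, 0), (-1, 1, 0), (-1, 0, 1)}) :
    ∀ ε ∈ I, ε.1 = 0 ∨ ε.1 = 1 ∨ ε.1 = -1 := by
  subst hI; decide

/-- The in-layer contact offsets are labels of layer `0` (both signs; by `decide`). [folklore] -/
theorem c_offsets_six (hI : I = {(0, 1, 0), (0, -1, 0), (0, 0, 1), (0, 0, -1), (0, 1, -1), (0, -1, 1),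
      (1, 0, 0), (1, -1, 0), (1, 0, -1), (-1, 0, 0), (-1, 1, 0), (-1, 0, 1)}) :
    ∀ PQ ∈ sixOffsets, ((0 : ℤ), -PQ.1, -PQ.2) ∈ I ∧ ((0 : ℤ), PQ.1, PQ.2) ∈ I := by
  subst hI; decide

/-- The contact offsets towards the layer above are labels of layer `1` (by `decide`). [folklore] -/
theorem c_offsets_up (hI : I = {(0, 1, 0), (0, -1, 0), (0, 0, 1), (0, 0, -1), (0, 1, -1), (0, -1, 1),
      (1, 0, 0), (1, -1, 0), (1, 0, -1), (-1, 0, 0), (-1, 1, 0), (-1, 0, 1)}) :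
    (∀ PQ ∈ threeOffsets (-1), ((1 : ℤ), -PQ.1, -PQ.2) ∈ I) ∧
      ∀ PQ ∈ threeOffsets 1, ((1 : ℤ), PQ.1, PQ.2) ∈ I := by
  subst hI; decide

/-- The contact offsets towards the layer below are labels of layer `−1` (by `decide`). [folklore] -/
theorem c_offsets_down (hI : I = {(0, 1, 0), (0, -1, 0), (0, 0, 1), (0, 0, -1), (0, 1, -1), (0, -1, 1),
      (1, 0, 0), (1, -1, 0), (1, 0, -1), (-1, 0, 0), (-1, 1, 0), (-1, 0, 1)}) :
    (∀ PQ ∈ threeOffsets 1, ((-1 : ℤ), -PQ.1, -PQ.2) ∈ I) ∧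
      ∀ PQ ∈ threeOffsets (-1), ((-1 : ℤ), PQ.1, PQ.2) ∈ I := by
  subst hI; decide

/-- Every label is a contact offset of its layer (by `decide`). [folklore] -/
theorem c_star_offsets (hI : I = {(0, 1, 0), (0, -1, 0), (0, 0, 1), (0, 0, -1), (0, 1, -1), (0, -1, 1),
      (1, 0, 0), (1, -1, 0), (1, 0, -1), (-1, 0, 0), (-1, 1, 0), (-1, 0, 1)}) :
    ∀ ε ∈ I,
      (ε.1 = 0 ∧ (-ε.2.1, -ε.2.2) ∈ sixOffsets ∧ (ε.2.1, ε.2.2) ∈ sixOffsets) ∨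
      (ε.1 = 1 ∧ (-ε.2.1, -ε.2.2) ∈ threeOffsets (-1) ∧ (ε.2.1, ε.2.2) ∈ threeOffsets 1) ∨
      (ε.1 = -1 ∧ (-ε.2.1, -ε.2.2) ∈ threeOffsets 1 ∧ (ε.2.1, ε.2.2) ∈ threeOffsets (-1)) := by
  subst hI; decide

/-- **In the cuboctahedral link every edge lies in exactly one triangle** (by `decide`; adjacency of two
labels is `p − q ∈ I`, the link being locally the fcc lattice): two adjacent labels have exactly one common
neighbour. [folklore] -/
theorem c_edge_one_triangle (hI : I = {(0, 1, 0), (0, -1, 0), (0, 0, 1), (0, 0, -1), (0, 1, -1), (0, -1, 1),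
      (1, 0, 0), (1, -1, 0), (1, 0, -1), (-1, 0, 0), (-1, 1, 0), (-1, 0, 1)}) :
    ∀ p ∈ I, ∀ q ∈ I, p - q ∈ I → (I.filter fun r => p - r ∈ I ∧ q - r ∈ I).card = 1 := by
  subst hI; decide

/-- **The metric of the cuboctahedron is a function of its contact graph** (by `decide`): for two distinct
non-adjacent labels, `Q = 48 − 12 · #(common neighbours)` (square diagonals `24`, two common neighbours;
`36`, one; antipodes `48`, none). [folklore] -/
theorem c_classify (hI : I = {(0, 1, 0), (0, -1, 0), (0, 0, 1), (0, 0, -1), (0, 1, -1), (0, -1, 1),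
      (1, 0, 0), (1, -1, 0), (1, 0, -1), (-1, 0, 0), (-1, 1, 0), (-1, 0, 1)})
    (hQ : Q = fun e f => 3 * (2 * (e.2.1 - f.2.1) + (e.2.2 - f.2.2) + (e.1 - f.1)) ^ 2 +
      (3 * (e.2.2 - f.2.2) + (e.1 - f.1)) ^ 2 + 8 * (e.1 - f.1) ^ 2) :
    ∀ p ∈ I, ∀ q ∈ I, p ≠ q → p - q ∉ I →
      Q p q + 12 * (I.filter fun r => p - r ∈ I ∧ q - r ∈ I).card = 48 := by
  subst hI hQ; decide

/-- **Two labels are adjacent iff their metric form is `12`** (by `decide`). [folklore] -/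
theorem cq_eq_twelve_iff (hI : I = {(0, 1, 0), (0, -1, 0), (0, 0, 1), (0, 0, -1), (0, 1, -1), (0, -1, 1),
      (1, 0, 0), (1, -1, 0), (1, 0, -1), (-1, 0, 0), (-1, 1, 0), (-1, 0, 1)})
    (hQ : Q = fun e f => 3 * (2 * (e.2.1 - f.2.1) + (e.2.2 - f.2.2) + (e.1 - f.1)) ^ 2 +
      (3 * (e.2.2 - f.2.2) + (e.1 - f.1)) ^ 2 + 8 * (e.1 - f.1) ^ 2) :
    ∀ p ∈ I, ∀ q ∈ I, (Q p q = 12 ↔ p - q ∈ I) := by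
  subst hI hQ; decide

/-- Every label has metric form `12` to the root (by `decide`). [folklore] -/
theorem cq_root (hI : I = {(0, 1, 0), (0, -1, 0), (0, 0, 1), (0, 0, -1), (0, 1, -1), (0, -1, 1),
      (1, 0, 0), (1, -1, 0), (1, 0, -1), (-1, 0, 0), (-1, 1, 0), (-1, 0, 1)})
    (hQ : Q = fun e f => 3 * (2 * (e.2.1 - f.2.1) + (e.2.2 - f.2.2) + (e.1 - f.1)) ^ 2 +
      (3 * (e.2.2 - f.2.2) + (e.1 - f.1)) ^ 2 + 8 * (e.1 - f.1) ^ 2) :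
    ∀ p ∈ I, Q p 0 = 12 := by
  subst hI hQ; decide

/-- The metric form vanishes on the diagonal. [folklore] -/
theorem cq_self (hQ : Q = fun e f => 3 * (2 * (e.2.1 - f.2.1) + (e.2.2 - f.2.2) + (e.1 - f.1)) ^ 2 +
      (3 * (e.2.2 - f.2.2) + (e.1 - f.1)) ^ 2 + 8 * (e.1 - f.1) ^ 2) (p : ℤ × ℤ × ℤ) : Q p p = 0 := by
  subst hQ; simp

end Tables

/-! ## The letters around a c-type site -/

/-- At a c-type site `k` (`s (k − 1) = s k`) the letters of the layers `k + e`, `e ∈ {0, ±1}`, are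
`L + s k · e`. [folklore] -/
theorem haggLabel_cSite {s : ℤ → ℤ} {k : ℤ} (hu : s (k - 1) = s k) {e : ℤ} (he : e = 0 ∨ e = 1 ∨ e = -1) :
    haggLabel s (k + e) = haggLabel s k + s k * e := by
  rcases he with rfl | rfl | rfl
  · simp
  · rw [haggLabel_succ, mul_one]
  · have h1 := haggLabel_succ s (k - 1)
    rw [sub_add_cancel, hu] at h1
    rw [← sub_eq_add_neg]
    linarith

/-- Anchor of this part file (registered sub-goal `exactFrameC_part01_anchor` of stmt-AtomisticToContinuum-13603):
at a c-type site of a Hägg word the letter below is the letter minus the step. [folklore] -/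
theorem exactFrameC_part01_anchor : ∀ s : ℤ → ℤ, IsHaggSeq s → ∀ k : ℤ, s (k - 1) = s k →
    haggLabel s (k - 1) = haggLabel s k - s k := by
  intro s _ k hu
  have h := haggLabel_cSite hu (e := -1) (Or.inr (Or.inr rfl))
  rw [← sub_eq_add_neg] at h
  linarith

section CSite

variable {I : Finset (ℤ × ℤ × ℤ)} {Q : ℤ × ℤ × ℤ → ℤ × ℤ × ℤ → ℤ}
  {s : ℤ → ℤ} {u : ℤ × ℤ × ℤ} {N : ℤ × ℤ × ℤ → ℤ × ℤ × ℤ}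

/-- **The contacts of a c-type site.** For a Hägg word `s` and a site `u` with `s (u.1 − 1) = s u.1`, the sites
of the ideal stacking `barlowStacking 1 √(2/3) s` at distance `1` from the site `u` are exactly the labelled
neighbours `N ε`, `ε ∈ I`. [folklore] -/
theorem dist_eq_one_iff_nbrC (hI : I = {(0, 1, 0), (0, -1, 0), (0, 0, 1), (0, 0, -1), (0, 1, -1), (0, -1, 1),
      (1, 0, 0), (1, -1, 0), (1, 0, -1), (-1, 0, 0), (-1, 1, 0), (-1, 0, 1)})
    (hs : IsHaggSeq s) (hu : s (u.1 - 1) = s u.1)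
    (hN : ∀ ε, N ε = (u.1 + ε.1, u.2.1 + s u.1 * ε.2.1, u.2.2 + s u.1 * ε.2.2)) (w : ℤ × ℤ × ℤ) :
    dist (barlowPos 1 (Real.sqrt (2 / 3)) s u.1 u.2.1 u.2.2)
        (barlowPos 1 (Real.sqrt (2 / 3)) s w.1 w.2.1 w.2.2) = 1 ↔ ∃ ε ∈ I, w = N ε := by
  simp only [hN]
  obtain ⟨k, i, j⟩ := u
  obtain ⟨k', i', j'⟩ := w
  dsimp only at hu ⊢
  rw [dist_barlowPos_eq_iff hs one_pos sqrt_twoThirds_sq, hu]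
  rcases hs k with hσ | hσ <;> rw [hσ] <;> simp only [neg_neg, one_mul, neg_one_mul, Prod.mk.injEq]
  · constructor
    · rintro (⟨rfl, hm⟩ | ⟨rfl, hm⟩ | ⟨rfl, hm⟩)
      · refine ⟨(0, -(i - i'), -(j - j')), (c_offsets_six hI _ hm).1, ?_, ?_, ?_⟩ <;> dsimp only <;> omega
      · refine ⟨(1, -(i - i'), -(j - j')), (c_offsets_up hI).1 _ hm, ?_, ?_, ?_⟩ <;> dsimp only <;> omega
      · refine ⟨(-1, -(i - i'), -(j - j')), (c_offsets_down hI).1 _ hm, ?_, ?_, ?_⟩ <;> dsimp only <;> omega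
    · rintro ⟨ε, hε, rfl, rfl, rfl⟩
      have e : (i - (i + ε.2.1), j - (j + ε.2.2)) = (-ε.2.1, -ε.2.2) := by
        simp only [Prod.mk.injEq]; constructor <;> ring
      rw [e]
      rcases c_star_offsets hI ε hε with ⟨h1, h6, -⟩ | ⟨h1, h3, -⟩ | ⟨h1, h3, -⟩
      · exact Or.inl ⟨by omega, h6⟩
      · exact Or.inr (Or.inl ⟨by omega, h3⟩)
      · exact Or.inr (Or.inr ⟨by omega, h3⟩)
  · constructor
    · rintro (⟨rfl, hm⟩ | ⟨rfl, hm⟩ | ⟨rfl, hm⟩)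
      · refine ⟨(0, i - i', j - j'), (c_offsets_six hI _ hm).2, ?_, ?_, ?_⟩ <;> dsimp only <;> omega
      · refine ⟨(1, i - i', j - j'), (c_offsets_up hI).2 _ hm, ?_, ?_, ?_⟩ <;> dsimp only <;> omega
      · refine ⟨(-1, i - i', j - j'), (c_offsets_down hI).2 _ hm, ?_, ?_, ?_⟩ <;> dsimp only <;> omega
    · rintro ⟨ε, hε, rfl, rfl, rfl⟩
      have e : (i - (i + -ε.2.1), j - (j + -ε.2.2)) = (ε.2.1, ε.2.2) := by
        simp only [Prod.mk.injEq]; constructor <;> ring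
      rw [e]
      rcases c_star_offsets hI ε hε with ⟨h1, -, h6⟩ | ⟨h1, -, h3⟩ | ⟨h1, -, h3⟩
      · exact Or.inl ⟨by omega, h6⟩
      · exact Or.inr (Or.inl ⟨by omega, h3⟩)
      · exact Or.inr (Or.inr ⟨by omega, h3⟩)

/-- **The integer metric of the sites around a c-type site**: at the ideal ratio `h² = ⅔ a²`,
`12 · dist (N ε) (N ε')² = a² · Q ε ε'` for labels on the layers `0, ±1` (the letters of the layers `u.1 + e`
are `L + σ e`, and the lateral sign `σ` drops out of the squares). [folklore] -/
theorem twelve_mul_dist_sq_nbrC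
    (hQ : Q = fun e f => 3 * (2 * (e.2.1 - f.2.1) + (e.2.2 - f.2.2) + (e.1 - f.1)) ^ 2 +
      (3 * (e.2.2 - f.2.2) + (e.1 - f.1)) ^ 2 + 8 * (e.1 - f.1) ^ 2)
    (hs : IsHaggSeq s) (hu : s (u.1 - 1) = s u.1)
    (hN : ∀ ε, N ε = (u.1 + ε.1, u.2.1 + s u.1 * ε.2.1, u.2.2 + s u.1 * ε.2.2)) {a h : ℝ}
    (hh : h ^ 2 = 2 / 3 * a ^ 2) {ε ε' : ℤ × ℤ × ℤ} (h1 : ε.1 = 0 ∨ ε.1 = 1 ∨ ε.1 = -1)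
    (h2 : ε'.1 = 0 ∨ ε'.1 = 1 ∨ ε'.1 = -1) :
    12 * dist (barlowPos a h s (N ε).1 (N ε).2.1 (N ε).2.2)
        (barlowPos a h s (N ε').1 (N ε').2.1 (N ε').2.2) ^ 2 = a ^ 2 * (Q ε ε' : ℝ) := by
  subst hQ
  simp only [hN]
  obtain ⟨k, i, j⟩ := u
  dsimp only at hu ⊢
  rw [twelve_mul_dist_barlowPos_sq hh, haggLabel_cSite hu h1, haggLabel_cSite hu h2]
  congr 1
  have key : (3 * (2 * (i + s k * ε.2.1 - (i + s k * ε'.2.1)) + (j + s k * ε.2.2 - (j + s k * ε'.2.2)) +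
      (haggLabel s k + s k * ε.1 - (haggLabel s k + s k * ε'.1))) ^ 2 +
      (3 * (j + s k * ε.2.2 - (j + s k * ε'.2.2)) + (haggLabel s k + s k * ε.1 - (haggLabel s k + s k * ε'.1))) ^ 2 +
      8 * (k + ε.1 - (k + ε'.1)) ^ 2 : ℤ) = 3 * (2 * (ε.2.1 - ε'.2.1) + (ε.2.2 - ε'.2.2) + (ε.1 - ε'.1)) ^ 2 +
      (3 * (ε.2.2 - ε'.2.2) + (ε.1 - ε'.1)) ^ 2 + 8 * (ε.1 - ε'.1) ^ 2 := by
    rcases hs k with hσ | hσ <;> rw [hσ] <;> ring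
  exact_mod_cast key

/-- The root is the site with label `0`. [folklore] -/
theorem nbrC_zero (hN : ∀ ε, N ε = (u.1 + ε.1, u.2.1 + s u.1 * ε.2.1, u.2.2 + s u.1 * ε.2.2)) : N 0 = u := by
  rw [hN]; simp

/-- **Two contacts of a c-type site touch iff their labels differ by a label** (ideal stacking: the link is
locally the fcc lattice). [folklore] -/
theorem dist_nbrC_eq_one_iff (hI : I = {(0, 1, 0), (0, -1, 0), (0, 0, 1), (0, 0, -1), (0, 1, -1), (0, -1, 1),
      (1, 0, 0), (1, -1, 0), (1, 0, -1), (-1, 0, 0), (-1, 1, 0), (-1, 0, 1)})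
    (hQ : Q = fun e f => 3 * (2 * (e.2.1 - f.2.1) + (e.2.2 - f.2.2) + (e.1 - f.1)) ^ 2 +
      (3 * (e.2.2 - f.2.2) + (e.1 - f.1)) ^ 2 + 8 * (e.1 - f.1) ^ 2)
    (hs : IsHaggSeq s) (hu : s (u.1 - 1) = s u.1)
    (hN : ∀ ε, N ε = (u.1 + ε.1, u.2.1 + s u.1 * ε.2.1, u.2.2 + s u.1 * ε.2.2)) {ε ε' : ℤ × ℤ × ℤ}
    (hε : ε ∈ I) (hε' : ε' ∈ I) :
    dist (barlowPos 1 (Real.sqrt (2 / 3)) s (N ε).1 (N ε).2.1 (N ε).2.2)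
        (barlowPos 1 (Real.sqrt (2 / 3)) s (N ε').1 (N ε').2.1 (N ε').2.2) = 1 ↔ ε - ε' ∈ I := by
  have h12 := twelve_mul_dist_sq_nbrC hQ hs hu hN sqrt_twoThirds_sq (cIdx_fst_cases hI ε hε)
    (cIdx_fst_cases hI ε' hε')
  rw [one_pow, one_mul] at h12
  rw [← cq_eq_twelve_iff hI hQ ε hε ε' hε']
  constructor
  · intro hd
    rw [hd, one_pow, mul_one] at h12
    exact_mod_cast h12.symm
  · intro hq
    rw [hq] at h12
    push_cast at h12
    have h2 : dist (barlowPos 1 (Real.sqrt (2 / 3)) s (N ε).1 (N ε).2.1 (N ε).2.2)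
        (barlowPos 1 (Real.sqrt (2 / 3)) s (N ε').1 (N ε').2.1 (N ε').2.2) ^ 2 = 1 := by linarith
    rwa [pow_eq_one_iff_of_nonneg dist_nonneg two_ne_zero] at h2

/-- **The relaxed struts at the ideal ratio have length `a`.** [folklore] -/
theorem norm_strutC (hI : I = {(0, 1, 0), (0, -1, 0), (0, 0, 1), (0, 0, -1), (0, 1, -1), (0, -1, 1),
      (1, 0, 0), (1, -1, 0), (1, 0, -1), (-1, 0, 0), (-1, 1, 0), (-1, 0, 1)})
    (hQ : Q = fun e f => 3 * (2 * (e.2.1 - f.2.1) + (e.2.2 - f.2.2) + (e.1 - f.1)) ^ 2 +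
      (3 * (e.2.2 - f.2.2) + (e.1 - f.1)) ^ 2 + 8 * (e.1 - f.1) ^ 2)
    (hs : IsHaggSeq s) (hu : s (u.1 - 1) = s u.1)
    (hN : ∀ ε, N ε = (u.1 + ε.1, u.2.1 + s u.1 * ε.2.1, u.2.2 + s u.1 * ε.2.2)) {a h : ℝ} (ha : 0 ≤ a)
    (hh : h ^ 2 = 2 / 3 * a ^ 2) {ε : ℤ × ℤ × ℤ} (hε : ε ∈ I) :
    ‖barlowPos a h s (N ε).1 (N ε).2.1 (N ε).2.2 - barlowPos a h s u.1 u.2.1 u.2.2‖ = a := by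
  have h12 := twelve_mul_dist_sq_nbrC hQ hs hu hN hh (cIdx_fst_cases hI ε hε) (ε' := 0) (Or.inl rfl)
  rw [nbrC_zero hN, cq_root hI hQ ε hε, dist_eq_norm] at h12
  push_cast at h12
  have h2 : ‖barlowPos a h s (N ε).1 (N ε).2.1 (N ε).2.2 - barlowPos a h s u.1 u.2.1 u.2.2‖ ^ 2 = a ^ 2 := by
    linarith
  exact (sq_eq_sq₀ (norm_nonneg _) ha).1 h2

/-- **The relaxed struts of a c-type site are lattice vectors**:
`barlowPos a h s (N ε) − barlowPos a h s u = siteVec a h (σ (2ε₂ + ε₃ + ε₁), σ (3ε₃ + ε₁), ε₁)` for labels on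
the layers `0, ±1`, for every spacing `(a, h)`. [folklore] -/
theorem strut_eq_siteVec (hs : IsHaggSeq s) (hu : s (u.1 - 1) = s u.1)
    (hN : ∀ ε, N ε = (u.1 + ε.1, u.2.1 + s u.1 * ε.2.1, u.2.2 + s u.1 * ε.2.2)) (a h : ℝ)
    {ε : ℤ × ℤ × ℤ} (h1 : ε.1 = 0 ∨ ε.1 = 1 ∨ ε.1 = -1) :
    barlowPos a h s (N ε).1 (N ε).2.1 (N ε).2.2 - barlowPos a h s u.1 u.2.1 u.2.2 =
      siteVec a h (s u.1 * (2 * ε.2.1 + ε.2.2 + ε.1), s u.1 * (3 * ε.2.2 + ε.1), ε.1) := by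
  simp only [hN]
  obtain ⟨k, i, j⟩ := u
  dsimp only at hu ⊢
  have hL := haggLabel_cSite hu h1
  rcases hs k with hσ | hσ <;> rw [hσ] at hL ⊢ <;>
    ext l <;> fin_cases l <;> simp [siteVec, hL] <;> ring

/-- **Three independent struts**: the relaxed struts `(0,1,0), (0,0,1), (1,0,0)` of a c-type site are linearly
independent (`a, h ≠ 0`). [folklore] -/
theorem linearIndependent_strutsC (hs : IsHaggSeq s) (hu : s (u.1 - 1) = s u.1)
    (hN : ∀ ε, N ε = (u.1 + ε.1, u.2.1 + s u.1 * ε.2.1, u.2.2 + s u.1 * ε.2.2)) {a h : ℝ}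
    (ha : a ≠ 0) (hh : h ≠ 0) :
    LinearIndependent ℝ
      ![barlowPos a h s (N (0, 1, 0)).1 (N (0, 1, 0)).2.1 (N (0, 1, 0)).2.2 - barlowPos a h s u.1 u.2.1 u.2.2,
        barlowPos a h s (N (0, 0, 1)).1 (N (0, 0, 1)).2.1 (N (0, 0, 1)).2.2 - barlowPos a h s u.1 u.2.1 u.2.2,
        barlowPos a h s (N (1, 0, 0)).1 (N (1, 0, 0)).2.1 (N (1, 0, 0)).2.2 - barlowPos a h s u.1 u.2.1 u.2.2] := by
  rw [strut_eq_siteVec hs hu hN a h (Or.inl rfl), strut_eq_siteVec hs hu hN a h (Or.inl rfl),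
    strut_eq_siteVec hs hu hN a h (Or.inr (Or.inl rfl))]
  rcases hs u.1 with hσ | hσ <;> rw [hσ] <;> exact linearIndependent_siteVec ha hh (by decide)

end CSite

/-! ## The cuboctahedron `fccInt`: the same table, and the transport through a graph isomorphism -/

/-- **The metric of `fccInt` is the same function of its contact graph** (by `decide`): for two distinct
non-adjacent vectors, `6 |p − q|² = 48 − 12 · #(common neighbours)`. [folklore] -/
theorem fccInt_classify : ∀ p ∈ fccInt, ∀ q ∈ fccInt, p ≠ q → sqNormInt (p - q) ≠ 2 →
    6 * sqNormInt (p - q) +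
      12 * (fccInt.filter fun r => sqNormInt (p - r) = 2 ∧ sqNormInt (q - r) = 2).card = 48 := by
  decide

/-- Squared distances in a scaled integer pattern: `dist (v/√n) (w/√n)² = |v − w|² / n`. [folklore] -/
theorem dist_sq_scaledPattern {n : ℕ} (hn : n ≠ 0) (v w : Fin 3 → ℤ) :
    dist ((Real.sqrt n)⁻¹ • intVec v : EuclideanSpace ℝ (Fin 3)) ((Real.sqrt n)⁻¹ • intVec w) ^ 2 =
      sqNormInt (v - w) / n := by
  have hpos : (0 : ℝ) < Real.sqrt n := by positivity
  have h0 : (0 : ℝ) ≤ (sqNormInt (v - w) : ℝ) := by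
    have : (0 : ℤ) ≤ sqNormInt (v - w) := by unfold sqNormInt; positivity
    exact_mod_cast this
  rw [dist_eq_norm, ← smul_sub, intVec_sub, norm_smul, norm_inv, Real.norm_of_nonneg hpos.le, norm_intVec,
    mul_pow, inv_pow, Real.sq_sqrt (Nat.cast_nonneg n), Real.sq_sqrt h0, inv_mul_eq_div]

/-- **Transport of the metric through a contact-graph isomorphism.** If `Φ` maps the labels `I` bijectively
onto `fccInt` with `ε − ε' ∈ I ↔ |Φ ε − Φ ε'|² = 2`, then `6 |Φ ε − Φ ε'|² = Q ε ε'` for all pairs of labels: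
a graph isomorphism preserves the number of common neighbours (`c_classify`, `fccInt_classify`) — every
isomorphism of the cuboctahedral link onto the cuboctahedron is induced by a similarity. [folklore] -/
theorem six_mul_sqNormInt_eq {I : Finset (ℤ × ℤ × ℤ)} {Q : ℤ × ℤ × ℤ → ℤ × ℤ × ℤ → ℤ}
    (hI : I = {(0, 1, 0), (0, -1, 0), (0, 0, 1), (0, 0, -1), (0, 1, -1), (0, -1, 1),
      (1, 0, 0), (1, -1, 0), (1, 0, -1), (-1, 0, 0), (-1, 1, 0), (-1, 0, 1)})
    (hQ : Q = fun e f => 3 * (2 * (e.2.1 - f.2.1) + (e.2.2 - f.2.2) + (e.1 - f.1)) ^ 2 +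
      (3 * (e.2.2 - f.2.2) + (e.1 - f.1)) ^ 2 + 8 * (e.1 - f.1) ^ 2)
    {Φ : ℤ × ℤ × ℤ → (Fin 3 → ℤ)} (hinj : Set.InjOn Φ ↑I) (hmaps : Set.MapsTo Φ ↑I ↑fccInt)
    (hsurj : Set.SurjOn Φ ↑I ↑fccInt)
    (hadj : ∀ ε ∈ I, ∀ ε' ∈ I, (ε - ε' ∈ I ↔ sqNormInt (Φ ε - Φ ε') = 2)) :
    ∀ ε ∈ I, ∀ ε' ∈ I, 6 * sqNormInt (Φ ε - Φ ε') = Q ε ε' := by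
  intro ε hε ε' hε'
  by_cases heq : ε = ε'
  · subst heq
    rw [cq_self hQ]
    simp [sqNormInt]
  have hne : Φ ε ≠ Φ ε' := fun h => heq (hinj hε hε' h)
  by_cases hq : ε - ε' ∈ I
  · rw [(cq_eq_twelve_iff hI hQ ε hε ε' hε').2 hq, (hadj ε hε ε' hε').1 hq]; norm_num
  have hq' : sqNormInt (Φ ε - Φ ε') ≠ 2 := fun h => hq ((hadj ε hε ε' hε').2 h)
  have hF := fccInt_classify _ (hmaps hε) _ (hmaps hε') hne hq'
  have hIc := c_classify hI hQ ε hε ε' hε' heq hq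
  have hset : (fccInt.filter fun r => sqNormInt (Φ ε - r) = 2 ∧ sqNormInt (Φ ε' - r) = 2) =
      (I.filter fun γ => ε - γ ∈ I ∧ ε' - γ ∈ I).image Φ := by
    ext r
    simp only [Finset.mem_filter, Finset.mem_image]
    constructor
    · rintro ⟨hr, h1, h2⟩
      obtain ⟨γ, hγ, rfl⟩ := hsurj (Finset.mem_coe.2 hr)
      exact ⟨γ, ⟨hγ, (hadj ε hε γ hγ).2 h1, (hadj ε' hε' γ hγ).2 h2⟩, rfl⟩
    · rintro ⟨γ, ⟨hγ, h1, h2⟩, rfl⟩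
      exact ⟨hmaps hγ, (hadj ε hε γ hγ).1 h1, (hadj ε' hε' γ hγ).1 h2⟩
  have hcard : (fccInt.filter fun r => sqNormInt (Φ ε - r) = 2 ∧ sqNormInt (Φ ε' - r) = 2).card =
      (I.filter fun γ => ε - γ ∈ I ∧ ε' - γ ∈ I).card := by
    rw [hset]
    exact Finset.card_image_of_injOn fun x hx y hy hxy =>
      hinj (Finset.mem_filter.1 (Finset.mem_coe.1 hx)).1 (Finset.mem_filter.1 (Finset.mem_coe.1 hy)).1 hxy
  rw [hcard] at hF
  linarith

end Summit.AtomisticToContinuum.Crystallization.Theorems.PalmGoodLaw.ExactFrameC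

end
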